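import Literature.MathematicalPhysics.QuantumFieldTheory.Balaban1983to89.B7Prop1Local

/-!
# `Balaban1983to89.B12Prop2Claims260` — T. Bałaban, *Renormalization group approach to lattice gauge field
# theories. I*, Commun. Math. Phys. **109** (1987) 249–301 [Balaban1987RG1]: the two in-text claims "by Proposition 2
# [12]" of p. 260 (after (1.2): `U ∈ U_k(ε₀) ⇒ |V(∂p′) − 1| < 2ε₀` on `T_1^{(k)}`, `V = M^k(U)`) and of p. 265 (after
# (2.1): `U_{k+1}(W) ∈ U_{k+1}(ε₀) ⇒ |W(∂p′) − 1| < 2ε₀` on `T^{(k+1)}`), TYPED in printed form and PROVED for the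
# concrete `k`-fold block average (43) of [12] on `ℤ^d` (model instance `B7Prop2Explicit.avgIter`) from the tree's
# kernel proof of Proposition 2 of [12] (`B7Prop2Explicit`, `B7Prop2SpecialUnitary`, printed locality `B7Prop1Local`)

statement-level skeleton of published theorems with citation tags; proofs where landed; nothing here is a claim
about the Yang–Mills mass gap

PDF held: `paper:balaban1987-cmp109-rg-i-small-field` (journal page = PDF page + 248); pp. 260, 265 (PDF 12, 17)
read from the held text AND from the x2 page renders
`pub-balaban/b2b-balaban-ref1/pages/1987-cmp109-rg-I-small-field/…-p012-x2.png`, `…-p017-x2.png` (read as images: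
(1.1), (1.2), (2.1)–(2.3) and the two sentences).  "[12]" = T. Bałaban, *Averaging operations for lattice gauge
theories*, Commun. Math. Phys. **98** (1985) 17–51 [Balaban1985Averaging] (cell paper B7), Proposition 2 (52)–(54)
p. 26, PROVED in the tree for the concrete average (42)/(43) on `ℤ^d`: `B7Prop2Explicit.prop2_explicit(_lt_two)`
(gauge groups closed under (42) at radius `1/4`, e.g. `U(N)`), `B7Prop2SpecialUnitary.prop2_explicit_at(_lt_two)`
(closed at a radius `t`, e.g. `SU(N)`), `B7Prop1Local.prop2_local_at` (the printed locality).  "[15]" = *The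
variational problem and background fields …*, CMP **102** (1985) [Balaban1985Variational] (B11), Theorem 1
(`B11.Thm1Printed`, a statement row — its converse direction of the p. 260 sentence is NOT treated here).

WHAT IS REPRODUCED.  SKELETON rows `B12.Eq1.2` (reader r09 `ROWS-B12.md`: "space U_k(ε₀) … claims: ⇒
|V(∂p′)−1| < 2ε₀ (Prop 2 [12]); ⇐ with 2ε₀ → B₃⁻¹ε₀ (Thm 1 [15]) — `Setup.RegularSpace`, `PlaqSmall`; concrete
J-formula and the two implications: absent") — the "⇒" implication only — and `B12.Eq2.1` ("W regular with
U_{k+1}(W) ∈ U_{k+1}(ε₀) (⇒ |W(∂p′)−1| < 2ε₀, Prop 2 [12])" — that parenthetical claim).  Mega-formalization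
`lit-balaban`, HOME `run/shared/lean/pub/lit-balaban/`, Phase-2 proof seat `p29` gen 2, unit `lit-balaban-p29`
(companion of `B14.Claim264`, the [III] p. 264 claim by the same Proposition).

THE PRINTED TEXT.  p. 260 (verbatim, render p012): *"They are determined by regular gauge field configurations V
given on the unit lattice T_1^{(k)}. … there exists exactly one regular, critical orbit of the functional U → A(U),
U : Ū^k = M^k(U) = V on T^{(k)}, (1.1) … We denote by U_k(V), or simply U_k, a configuration in the minimal orbit. …
It is defined on configurations belonging to the space U_k(ε₀), i.e., U_k(V) ∈ U_k(ε₀). The space … is defined as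
the set of all configurations U satisfying the following regularity properties: |U(∂p) − 1| = |(∂U)(p) − 1| < ε₀η²,
η = L^{−k}, p ∈ T, |J| < ε₀ on T, J = D*_U η^{−2}π Im ∂U, (1.2) with ε₀ sufficiently small. By Proposition 2 [12] this
condition implies that |V(∂p′) − 1| < 2ε₀ for p′ ∈ T_1^{(k)}, and is implied by the condition on V, with 2ε₀
replaced by B₃⁻¹ε₀, see Theorem 1 [15]."*  p. 265 (verbatim, render p017): *"We consider the new action on regular
configurations W defined on T^{(k+1)}. More exactly we assume that W is so regular that the minimal configurations
U_{k+1}(W) exist and belong to the space U_{k+1}(ε₀). By Proposition 2 from the paper [12] this implies that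
|W(∂p′) − 1| < 2ε₀ for p′ ∈ T^{(k+1)}."*

THE ARGUMENT FORMALISED (print: claims by reference).  The first condition of (1.2), `|U(∂p) − 1| < ε₀η²`,
`η = L^{−k}`, IS the hypothesis (52) of Prop. 2 of [12] with `α₀ = ε₀`; `V = M^k(U)` is the constraint (1.1) for
`U = U_k(V)` (p. 265: `W = M^{k+1}(U_{k+1}(W))`, (1.1) at level `k+1`); (54) gives `|M^k(U)(∂p′) − 1| < ε₀ + 2C₀ε₀² <
2ε₀` for `C₀ε₀ ≤ ⅓`, `2ε₀ ≤ c₂′` — the printed `2ε₀`.  This is `B7Prop2Explicit.prop2_explicit_lt_two` /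
`B7Prop2SpecialUnitary.prop2_explicit_at_lt_two` read through the B12 dictionary; this file adds the printed forms
(`Claim260Printed`, `Claim265Printed`), their discharge for unitary configurations with ONE displayed threshold
`L²ε₀ ≤ c(d)` (`smallness_of_L2`), the printed locality, and `SU(N)` — nothing of [12] is restated.  PROVED (kernel;
axioms `propext`, `Classical.choice`, `Quot.sound`).

MODEL / DECLARED DEVIATIONS (referee columns F6/F7; those of `B7Prop2Explicit` (b)–(e) inherited).  (M1) LATTICE:
`T = T_η`, `η = L^{−k}`, is read on `ℤ^d` (no torus; `B7Prop2Explicit` DICTIONARY); `M^k = avgIter L · k`;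
`sup_{p′ ∈ T_1^{(k)}} |V(∂p′) − 1| = pdev (avgIter L U k)`.  (M2) Only the FIRST condition of (1.2) is used (the
`J`-condition `|J| < ε₀` plays no role in the claim, exactly as in print: Prop. 2 of [12] sees plaquettes only); the
identification `V = M^k(U_k(V))` ((1.1)) is the DICTIONARY — the theorems conclude on `M^k(U)` for an arbitrary
`G`-valued `U` and apply verbatim to `U = U_k(V)`.  (M3) LOCALITY: print has (1.2) on all of `T`; §§2–3 use the
strict bound on the supremum `pdev U` (the form of (52) in `B7Prop2Explicit`); §4 records the sharper printed
locality of [12] anyway (hypothesis on the four `k`-blocks at the corners of `p′`).  (M4) SMALLNESS: "ε₀ sufficiently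
small" (p. 260), `L` fixed: explicitly `C₀(d)ε₀ ≤ ⅓`, `2ε₀ ≤ c₂′(d, L) = 1/(512(d+1)(d+4)L²)` (for a general `G` also
the closure radius `32(d+1)(d+4)L²ε₀ ≤ t`); in the printed forms ONE threshold `L²ε₀ ≤ c`, `c = 1/(3C₀(d)) =
1/(43392(d+1)²(d+4)²)` chosen before `L`, `k`, `ε₀`.  (M5) GAUGE GROUP: print `G = SU(2)` "superficial[ly]" (p. 260),
[12] has `G ⊂ U(N)`: the printed forms are stated for unitary-valued configurations in a non-trivial C⋆-algebra
(`M_N(ℂ)` with the operator norm included), §5 gives `SU(N)` with the `SU(N)`-valuedness of all `M^j(U)`.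
(M6) `k ≥ 0`, `L ≥ 2` ([12] p. 17 "`L > 1`").  Net new unproved facts: 0 (both printed Props discharged here).
-/

open scoped BigOperators
open NormedSpace Finset

namespace Literature.MathematicalPhysics.QuantumFieldTheory.Balaban1983to89.B12Prop2Claims260

open B7Prop1Explicit B7Prop2Explicit B7Prop2SpecialUnitary B7Prop1Local MatrixLog

-- `Site` alone could resolve to the torus sites of `Setup.lean` through a parent namespace; re-export the `ℤ^d`
-- sites `Fin d → ℤ` of `B7Prop1Explicit`.
export B7Prop1Explicit (Site)

variable {d : ℕ}

/-! ## §1 The smallness "ε₀ sufficiently small" made explicit -/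

/-- **One displayed threshold for "ε₀ sufficiently small" (p. 260)** (M4): `L²ε₀ ≤ 1/(3C₀(d))`, `L ≥ 1` ⟹ the three
smallness conditions of Prop. 2 of [12] at `α₀ = ε₀`: `C₀ε₀ ≤ ⅓`, `2ε₀ ≤ c₂′(d, L)`, and the closure-radius condition
`32(d+1)(d+4)L²ε₀ ≤ 1/4` of a gauge group closed under (42) at radius `1/4` (e.g. `U(N)`).
[cite: Balaban1987RG1, (1.2) p.260] -/
theorem smallness_of_L2 {L : ℕ} (hL : 1 ≤ L) {ε₀ : ℝ} (hε : 0 ≤ ε₀) (h : (L : ℝ) ^ 2 * ε₀ ≤ 1 / (3 * C0 d)) :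
    C0 d * ε₀ ≤ 1 / 3 ∧ 2 * ε₀ ≤ c2' d L ∧ 32 * ((d : ℝ) + 1) * (d + 4) * (L : ℝ) ^ 2 * ε₀ ≤ 1 / 4 := by
  have hLr : (1 : ℝ) ≤ L := by exact_mod_cast hL
  have hC := C0_pos d
  have hd0 : (0 : ℝ) ≤ d := Nat.cast_nonneg d
  have hL2 : (1 : ℝ) ≤ (L : ℝ) ^ 2 := one_le_pow₀ hLr
  -- `C₀ L² ε₀ ≤ 1/3`
  have h1 : C0 d * ((L : ℝ) ^ 2 * ε₀) ≤ 1 / 3 := by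
    have := mul_le_mul_of_nonneg_left h hC.le
    rwa [show C0 d * (1 / (3 * C0 d)) = 1 / 3 by field_simp] at this
  have hε2 : ε₀ ≤ (L : ℝ) ^ 2 * ε₀ := by nlinarith
  have hA : C0 d * ε₀ ≤ 1 / 3 := (mul_le_mul_of_nonneg_left hε2 hC.le).trans h1
  -- `2ε₀ ≤ c₂′ = 1/(512(d+1)(d+4)L²)` ⟸ `1024(d+1)(d+4)L²ε₀ ≤ 1` ⟸ `1024(d+1)(d+4) ≤ C₀`
  have hpos : (0 : ℝ) < 512 * ((d : ℝ) + 1) * (d + 4) * (L : ℝ) ^ 2 := by positivity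
  have hK : 1024 * ((d : ℝ) + 1) * (d + 4) ≤ C0 d := by
    unfold C0; nlinarith [sq_nonneg ((d : ℝ) + 1), sq_nonneg ((d : ℝ) + 4), mul_nonneg hd0 hd0]
  have hB' : 1024 * ((d : ℝ) + 1) * (d + 4) * ((L : ℝ) ^ 2 * ε₀) ≤ 1 / 3 :=
    (mul_le_mul_of_nonneg_right hK (by positivity)).trans h1
  have hB : 2 * ε₀ ≤ c2' d L := by
    unfold c2'
    rw [le_div_iff₀ hpos]
    have : 2 * ε₀ * (512 * ((d : ℝ) + 1) * (d + 4) * (L : ℝ) ^ 2)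
        = 1024 * ((d : ℝ) + 1) * (d + 4) * ((L : ℝ) ^ 2 * ε₀) := by ring
    rw [this]; linarith
  refine ⟨hA, hB, ?_⟩
  have hB2 := hB
  unfold c2' at hB2
  rw [le_div_iff₀ hpos] at hB2
  nlinarith [hB2]

/-- The closure radius `1/4` of the unitary group is implied by `2ε₀ ≤ c₂′` alone:
`32(d+1)(d+4)L²ε₀ = 16(d+1)(d+4)L²·(2ε₀) ≤ 16(d+1)(d+4)L²·c₂′ = 1/32 ≤ 1/4`. [cite: Balaban1987RG1, (1.2) p.260] -/
theorem radius_of_c2' {L : ℕ} (hL : 1 ≤ L) {ε₀ : ℝ} (h : 2 * ε₀ ≤ c2' d L) :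
    32 * ((d : ℝ) + 1) * (d + 4) * (L : ℝ) ^ 2 * ε₀ ≤ 1 / 4 := by
  have hLr : (1 : ℝ) ≤ L := by exact_mod_cast hL
  have hpos : (0 : ℝ) < 512 * ((d : ℝ) + 1) * (d + 4) * (L : ℝ) ^ 2 := by positivity
  have h1 : 2 * ε₀ ≤ 1 / (512 * ((d : ℝ) + 1) * (d + 4) * (L : ℝ) ^ 2) := h
  rw [le_div_iff₀ hpos] at h1
  nlinarith [h1]

/-! ## §2 The printed claims, typed -/

section Printed

/-- **B12 p. 260 (verbatim): *"|U(∂p) − 1| = |(∂U)(p) − 1| < ε₀η², η = L^{−k}, p ∈ T, … (1.2) with ε₀ sufficiently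
small. By Proposition 2 [12] this condition implies that |V(∂p′) − 1| < 2ε₀ for p′ ∈ T_1^{(k)}"*** (`V = M^k(U)` by
(1.1)) — printed form over the concrete `k`-fold average (43) of [12] on `ℤ^d`: there is `c > 0` (depending on `d`
only) such that for every `L ≥ 2`, every `k`, every `ε₀ > 0` with `L²ε₀ ≤ c`, and every unitary-valued
configuration `U` on `T_η ≅ ℤ^d` with `sup_p |U(∂p) − 1| < ε₀η²` (the first condition of (1.2)), `sup_{p′}
|M^k(U)(∂p′) − 1| < 2ε₀`.  (Model notes M1–M6 of the file header.) [cite: Balaban1987RG1, (1.2) p.260] -/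
def Claim260Printed (d : ℕ) (𝔸 : Type*) [CStarAlgebra 𝔸] [Nontrivial 𝔸] : Prop :=
  ∃ c : ℝ, 0 < c ∧ ∀ L : ℕ, 2 ≤ L → ∀ k : ℕ, ∀ ε₀ : ℝ, 0 < ε₀ → (L : ℝ) ^ 2 * ε₀ ≤ c →
    ∀ (U : Site d → Fin d → 𝔸ˣ), (∀ x κ, U x κ ∈ unitaryUnits 𝔸) →
      pdev U < ε₀ * (((L : ℝ) ^ k)⁻¹) ^ 2 → pdev (avgIter L U k) < 2 * ε₀

/-- **B12 p. 265 (verbatim): *"More exactly we assume that W is so regular that the minimal configurations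
U_{k+1}(W) exist and belong to the space U_{k+1}(ε₀). By Proposition 2 from the paper [12] this implies that
|W(∂p′) − 1| < 2ε₀ for p′ ∈ T^{(k+1)}."*** (`W = Ū^{k+1}_{k+1} = M^{k+1}(U_{k+1}(W))`, (1.1) at level `k+1`) — printed
form: as `Claim260Printed` at level `k+1` (`U = U_{k+1}(W)` on `T_η`, `η = L^{−(k+1)}`). [cite: Balaban1987RG1, p.265 (after (2.1))] -/
def Claim265Printed (d : ℕ) (𝔸 : Type*) [CStarAlgebra 𝔸] [Nontrivial 𝔸] : Prop :=
  ∃ c : ℝ, 0 < c ∧ ∀ L : ℕ, 2 ≤ L → ∀ k : ℕ, ∀ ε₀ : ℝ, 0 < ε₀ → (L : ℝ) ^ 2 * ε₀ ≤ c →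
    ∀ (U : Site d → Fin d → 𝔸ˣ), (∀ x κ, U x κ ∈ unitaryUnits 𝔸) →
      pdev U < ε₀ * (((L : ℝ) ^ (k + 1))⁻¹) ^ 2 → pdev (avgIter L U (k + 1)) < 2 * ε₀

end Printed

/-! ## §3 Discharge for unitary configurations (`G = U(N) ⊂ M_N(ℂ)`, operator norm, included) -/

section Unitary

variable {𝔸 : Type*} [CStarAlgebra 𝔸] [Nontrivial 𝔸]

/-- **p. 260 for unitary configurations, explicit smallness:** `L ≥ 2`, `U` unitary-valued on `ηℤ^d ≅ ℤ^d` with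
`sup_p |U(∂p) − 1| < ε₀η²`, `η = L^{−k}`, `C₀ε₀ ≤ ⅓`, `2ε₀ ≤ c₂′` ⟹ `sup_{p′} |M^k(U)(∂p′) − 1| < 2ε₀` AND every
`M^j(U)`, `j ≤ k`, is unitary — Proposition 2 (54) of [12] (`B7Prop2Explicit.prop2_explicit(_lt_two)`,
`avgClosed_unitaryUnits`) read through the dictionary `α₀ = ε₀`, `V = M^k(U)`. [cite: Balaban1987RG1, (1.2) p.260] -/
theorem claim260_unitary (L : ℕ) (hL : 2 ≤ L) (k : ℕ) (U : Site d → Fin d → 𝔸ˣ)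
    (hU : ∀ x κ, U x κ ∈ unitaryUnits 𝔸) {ε₀ : ℝ} (hε : 0 < ε₀) (hC : C0 d * ε₀ ≤ 1 / 3)
    (hc2' : 2 * ε₀ ≤ c2' d L) (h12 : pdev U < ε₀ * (((L : ℝ) ^ k)⁻¹) ^ 2) :
    pdev (avgIter L U k) < 2 * ε₀ ∧ ∀ j ≤ k, ∀ x κ, avgIter L U j x κ ∈ unitaryUnits 𝔸 :=
  ⟨prop2_explicit_lt_two L hL (avgClosed_unitaryUnits d L) k U hU hε hC hc2' h12,
    (prop2_explicit L hL (avgClosed_unitaryUnits d L) k U hU hε hC hc2' h12).2⟩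

/-- **The bound at a single plaquette `p′ ∈ T_1^{(k)}`** (lower-left corner `z`, directions `μ, ν`):
`|V(∂p′) − 1| = |M^k(U)(∂p′) − 1| < 2ε₀`. [cite: Balaban1987RG1, (1.2) p.260] -/
theorem claim260_unitary_plaq (L : ℕ) (hL : 2 ≤ L) (k : ℕ) (U : Site d → Fin d → 𝔸ˣ)
    (hU : ∀ x κ, U x κ ∈ unitaryUnits 𝔸) {ε₀ : ℝ} (hε : 0 < ε₀) (hC : C0 d * ε₀ ≤ 1 / 3)
    (hc2' : 2 * ε₀ ≤ c2' d L) (h12 : pdev U < ε₀ * (((L : ℝ) ^ k)⁻¹) ^ 2) (z : Site d) (μ ν : Fin d) :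
    ‖((hol (avgIter L U k) z (plaqWord μ ν) : 𝔸ˣ) : 𝔸) - 1‖ < 2 * ε₀ := by
  obtain ⟨hlt, hmem⟩ := claim260_unitary L hL k U hU hε hC hc2' h12
  have hU1 : ∀ x κ, avgIter L U k x κ ∈ U1 𝔸 := fun x κ => unitaryUnits_le_U1 (hmem k le_rfl x κ)
  exact (le_pdev hU1 z μ ν).trans_lt hlt

variable (d 𝔸) in
/-- **`Claim260Printed` HOLDS**, with `c = 1/(3C₀(d)) = 1/(43392(d+1)²(d+4)²)` (`smallness_of_L2` +
`claim260_unitary`). [cite: Balaban1987RG1, (1.2) p.260] -/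
theorem Claim260Printed_holds : Claim260Printed d 𝔸 := by
  refine ⟨1 / (3 * C0 d), by have := C0_pos d; positivity, ?_⟩
  intro L hL k ε₀ hε hsmall U hU h12
  obtain ⟨hC, hc2', -⟩ := smallness_of_L2 (d := d) (le_trans (by norm_num) hL) hε.le hsmall
  exact (claim260_unitary L hL k U hU hε hC hc2' h12).1

variable (d 𝔸) in
/-- **`Claim265Printed` HOLDS** — the p. 265 sentence is the p. 260 one at level `k+1` (same constant `c`).
[cite: Balaban1987RG1, p.265 (after (2.1))] -/
theorem Claim265Printed_holds : Claim265Printed d 𝔸 := by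
  obtain ⟨c, hc, h⟩ := Claim260Printed_holds d 𝔸
  exact ⟨c, hc, fun L hL k => h L hL (k + 1)⟩

/-- **p. 265 explicit:** `U = U_{k+1}(W) ∈ U_{k+1}(ε₀)` (first condition, `η = L^{−(k+1)}`), `C₀ε₀ ≤ ⅓`, `2ε₀ ≤ c₂′`
⟹ `W = M^{k+1}(U)` has `sup_{p′ ∈ T^{(k+1)}} |W(∂p′) − 1| < 2ε₀`, and — (2.3) `V^{(k)} = Ū^k_{k+1} = M^k(U_{k+1})` —
every intermediate average `M^j(U)`, `j ≤ k+1`, is unitary. [cite: Balaban1987RG1, p.265 (after (2.1)); (2.3) p.265] -/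
theorem claim265_unitary (L : ℕ) (hL : 2 ≤ L) (k : ℕ) (U : Site d → Fin d → 𝔸ˣ)
    (hU : ∀ x κ, U x κ ∈ unitaryUnits 𝔸) {ε₀ : ℝ} (hε : 0 < ε₀) (hC : C0 d * ε₀ ≤ 1 / 3)
    (hc2' : 2 * ε₀ ≤ c2' d L) (h12 : pdev U < ε₀ * (((L : ℝ) ^ (k + 1))⁻¹) ^ 2) :
    pdev (avgIter L U (k + 1)) < 2 * ε₀ ∧ ∀ j ≤ k + 1, ∀ x κ, avgIter L U j x κ ∈ unitaryUnits 𝔸 :=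
  claim260_unitary L hL (k + 1) U hU hε hC hc2' h12

end Unitary

/-! ## §4 The printed locality of [12] ("enough to assume (52) for `p ⊂ B^k(x) ∪ B^k(y) ∪ B^k(z) ∪ B^k(w)`"):
(1.2) only on the four `k`-blocks at the corners of `p′` (tree `B7Prop1Local.prop2_local_at`) -/

section Local

variable {𝔸 : Type*} [NormedRing 𝔸] [NormOneClass 𝔸] [NormedAlgebra ℂ 𝔸] [CompleteSpace 𝔸]

/-- **p. 260 with the locality of [12], for a gauge group closed under (42) at radius `t`:** for a plaquette `p′` of
`T_1^{(k)}` (lower-left corner `z`, directions `μ, ν`, in `k`-lattice coordinates), the first condition of (1.2) as a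
strict bound on the supremum over the `η`-plaquettes inside the four `k`-blocks at the corners of `p′` ONLY
(`pdevOn (loK L k z) (plaqHiK L k z μ ν)`), with `C₀ε₀ ≤ ⅓`, `2ε₀ ≤ c₂′`, `32(d+1)(d+4)L²ε₀ ≤ t`, gives
`|M^k(U)(∂p′) − 1| < 2ε₀`. [cite: Balaban1987RG1, (1.2) p.260] -/
theorem claim260_local_at (L : ℕ) (hL : 2 ≤ L) {G : Subgroup 𝔸ˣ} {t : ℝ} (hG : AvgClosedAt d t L G) (k : ℕ)
    (U : Site d → Fin d → 𝔸ˣ) (hU : ∀ x κ, U x κ ∈ G) {ε₀ : ℝ} (hε : 0 < ε₀) (hC : C0 d * ε₀ ≤ 1 / 3)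
    (hc2' : 2 * ε₀ ≤ c2' d L) (ht : 32 * ((d : ℝ) + 1) * (d + 4) * (L : ℝ) ^ 2 * ε₀ ≤ t) (z : Site d)
    (μ ν : Fin d) (h12 : pdevOn (loK L k z) (plaqHiK L k z μ ν) U < ε₀ * (((L : ℝ) ^ k)⁻¹) ^ 2) :
    ‖((hol (avgIter L U k) z (plaqWord μ ν) : 𝔸ˣ) : 𝔸) - 1‖ < 2 * ε₀ := by
  have h := prop2_local_at L hL hG k U hU hε hC hc2' ht z μ ν h12
  have h2 := B7.prop2_bound_lt_two_alpha (C0 d) ε₀ hε hC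
  linarith

end Local

section LocalUnitary

variable {𝔸 : Type*} [CStarAlgebra 𝔸] [Nontrivial 𝔸]

/-- **p. 260 with the locality of [12] for unitary configurations** (`U(N) ⊂ M_N(ℂ)` included; closure radius `1/4`
from `2ε₀ ≤ c₂′`, `radius_of_c2'`). [cite: Balaban1987RG1, (1.2) p.260] -/
theorem claim260_local_unitary (L : ℕ) (hL : 2 ≤ L) (k : ℕ) (U : Site d → Fin d → 𝔸ˣ)
    (hU : ∀ x κ, U x κ ∈ unitaryUnits 𝔸) {ε₀ : ℝ} (hε : 0 < ε₀) (hC : C0 d * ε₀ ≤ 1 / 3)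
    (hc2' : 2 * ε₀ ≤ c2' d L) (z : Site d) (μ ν : Fin d)
    (h12 : pdevOn (loK L k z) (plaqHiK L k z μ ν) U < ε₀ * (((L : ℝ) ^ k)⁻¹) ^ 2) :
    ‖((hol (avgIter L U k) z (plaqWord μ ν) : 𝔸ˣ) : 𝔸) - 1‖ < 2 * ε₀ :=
  claim260_local_at L hL (avgClosedAt_of_avgClosed (avgClosed_unitaryUnits d L (𝔸 := 𝔸)) (le_refl (1 / 4 : ℝ)))
    k U hU hε hC hc2' (radius_of_c2' (le_trans (by norm_num) hL) hc2') z μ ν h12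

end LocalUnitary

/-! ## §5 `G = SU(N) ⊂ M_N(ℂ)` (operator norm): the bound together with the `SU(N)`-valuedness of all `M^j(U)` -/

section SpecialUnitary

variable {n : Type*} [Fintype n] [DecidableEq n] [Nonempty n]

open scoped Matrix.Norms.L2Operator

/-- **p. 260 for `SU(N)`-valued configurations** (`B7Prop2SpecialUnitary.avgClosedAt_specialUnitary`): `C₀ε₀ ≤ ⅓`,
`2ε₀ ≤ c₂′` and the one `G`-dependent condition `N·32(d+1)(d+4)L²ε₀ < π` ⟹ `sup_{p′} |M^k(U)(∂p′) − 1| < 2ε₀` and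
every `M^j(U)`, `j ≤ k`, is `SU(N)`-valued (p. 260: "restriction to the group SU(2) is superficial").
[cite: Balaban1987RG1, (1.2) p.260] -/
theorem claim260_specialUnitary (L : ℕ) (hL : 2 ≤ L) (k : ℕ) (U : Site d → Fin d → (Matrix n n ℂ)ˣ)
    (hU : ∀ x κ, U x κ ∈ specialUnitaryUnits n) {ε₀ : ℝ} (hε : 0 < ε₀) (hC : C0 d * ε₀ ≤ 1 / 3)
    (hc2' : 2 * ε₀ ≤ c2' d L)
    (hN : Fintype.card n * (32 * ((d : ℝ) + 1) * (d + 4) * (L : ℝ) ^ 2 * ε₀) < Real.pi)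
    (h12 : pdev U < ε₀ * (((L : ℝ) ^ k)⁻¹) ^ 2) :
    pdev (avgIter L U k) < 2 * ε₀ ∧ ∀ j ≤ k, ∀ x κ, avgIter L U j x κ ∈ specialUnitaryUnits n := by
  letI : CStarAlgebra (Matrix n n ℂ) := {}
  have hG := avgClosedAt_specialUnitary d L (radius_of_c2' (d := d) (le_trans (by norm_num) hL) hc2') hN
  exact ⟨prop2_explicit_at_lt_two L hL hG k U hU hε hC hc2' le_rfl h12,
    (prop2_explicit_at L hL hG k U hU hε hC hc2' le_rfl h12).2⟩

end SpecialUnitary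

-- Axiom audit (scratch, not shipped): `#print axioms` of `Claim260Printed_holds`, `Claim265Printed_holds`,
-- `claim260_local_unitary`, `claim260_specialUnitary` = [propext, Classical.choice, Quot.sound].

end Literature.MathematicalPhysics.QuantumFieldTheory.Balaban1983to89.B12Prop2Claims260
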